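import Summits.CriticalPhenomena.PercolationContinuityZ3.Theorems.PercNearOneGluingNoHeavyLowerTailSahiCombMixMixedThreeSlotK1b
import Summits.CriticalPhenomena.PercolationContinuityZ3.Theorems.PercNearOneGluingNoHeavyLowerTailSahiCombMixMixedThreeSlotK2b
import Summits.CriticalPhenomena.PercolationContinuityZ3.Theorems.PercNearOneGluingNoHeavyLowerTailSahiCombMixMixedThreeSlotK3b
import Summits.CriticalPhenomena.PercolationContinuityZ3.Theorems.PercNearOneGluingNoHeavyLowerTailSahiCombMixMixedFourSingle
import Summits.CriticalPhenomena.PercolationContinuityZ3.Theorems.PercNearOneGluingNoHeavyLowerTailSahiCombMixCaterpillar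

/-!
# The comb (tensor-Bernstein) hierarchy for Sahi's `E_k`, LIX: the MIXED one-coordinate step over FOUR events is a THEOREM — every quadruple of
# common-order monotone decision lists is hereditarily comb-positive

Support file of the one-cut programme (crux `NoHeavyLowerTail`, stmt-CriticalPhenomena-4575; cell `prim-masterthm`, seat P3, gen 10;
`run/shared/lean/prim/prim-masterthm/prim-masterthm-p3/HIERARCHY.md` §18).  Gen 9's conditional assembly `combHereditary_orAndCoord_four_of_cells`
(`…SahiCombMixMixedFour`) needed two cell interfaces: `CombFourSingletonMixedCells` (discharged in `…SahiCombMixMixedFourSingle`) and `CombCanonThreeSlotMixedCells k`,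
`k = 0..3` — discharged HERE (`k = 0`: the top row of the mixed triple theorem; `k = 1,2,3`: `…SahiCombMixMixedThreeSlotK{1,2,3}{a,b}`, through the five master cells of
`…SahiCombMixMixedThreeSlotCells`).  Consequences, all unconditional (standard axioms):
* **`combHereditary_orAndCoord_four`** — for every finite cube, every quadruple `U` of increasing events ignoring `e` whose ∩-closed family is comb-positive at every
  order, and ALL selectors `G₁` (members receiving `∪ {e∈ω}`) and `G₂` (members receiving `∩ {e∈ω}`), the mixed family `orAndCoord U e G₁ G₂` is again `CombHereditary`;
* **`combHereditary_grow₂_four`** — any such quadruple determined by `S`, grown by ANY list of mixed steps on pairwise distinct coordinates outside `S`, stays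
  `CombHereditary`;
* **`combHereditary_decisionList_four`** — from a constant start: EVERY QUADRUPLE OF MONOTONE READ-ONCE DECISION LISTS over a common coordinate order (member `j` at
  coordinate `e`: "accept if `e ∈ ω`" / "reject if `e ∉ ω`" / skip) is comb-positive at every order, i.e. every row `E_m` of its ∩-closed family is a nonnegative
  combination of the tensor-Bernstein basis in `p`; `combHereditary_decisionList_four_readOnce` — the same with the literals `{e ∈ ω}` replaced by arbitrary increasing
  gadgets on pairwise disjoint coordinate blocks; `sahiE_four_decisionList_nonneg` — in particular `E_4 ≥ 0` under every product measure.
This completes the one-coordinate induction for four events with all three step types (OR = comb H-MIX(4), gen 8; AND, gen 9; mixed, this gen) and strictly contains the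
caterpillar / grown classes of `…SahiCombMixCaterpillar` / `…SahiCombMixGrow`.
HONEST FRAMING: four members only; nothing here asserts (M⁺-k) or `C_k` for `k ≥ 3` in general. [this work]
-/

noncomputable section

open scoped Classical

namespace Summit.CriticalPhenomena.PercolationContinuityZ3.Theorems

open Finset Function
open Literature.Combinatorics.Sahi2008
open Literature.Probability.Percolation (DeterminedBy)
open Literature.Probability.Percolation.DecisionTree (ind)
open SahiComb
open SahiCombDisjunct (orCoord)
open SahiCombHereditary (CombHereditary)

variable {ι : Type} [Fintype ι]

namespace SahiCombMix

/-! ### The three-slot interface -/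

/-- **`CombCanonThreeSlotMixedCells 0`**: the slots are the members `0,1,2` themselves, so the cell is the top row of the mixed triple
`orAndCoord (U_0,U_1,U_2)` (`combHereditary_orAndCoord_three`). [this work] -/
theorem combCanonThreeSlotMixedCells_zero : CombCanonThreeSlotMixedCells 0 := by
  intro ι _ U e hUup hUe hU G₁ G₂
  have h3 := combHereditary_orAndCoord_three (![U 0, U 1, U 2] : Fin 3 → Set (Set ι)) e (![G₁ 0, G₁ 1, G₁ 2] : Fin 3 → Bool)
    (![G₂ 0, G₂ 1, G₂ 2] : Fin 3 → Bool) (fun l => by fin_cases l <;> exact hUup _) (fun l b => by fin_cases l <;> exact hUe _ b)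
    (hU.of_eq_biInter (![{0}, {1}, {2}] : Fin 3 → Finset (Fin 4)) (fun l => by fin_cases l <;> simp))
  refine (h3 3 (fun j => {j})).congr fun p => ?_
  congr 1; funext j
  fin_cases j <;> simp [SahiMixture.canonK_zero, orAndCoord]

/-- **All four mixed three-slot interfaces hold.** [this work] -/
theorem combCanonThreeSlotMixedCells_all : ∀ k : Fin 4, CombCanonThreeSlotMixedCells k := by
  intro k
  fin_cases k
  · exact combCanonThreeSlotMixedCells_zero
  · exact combCanonThreeSlotMixedCells_one
  · exact combCanonThreeSlotMixedCells_two
  · exact combCanonThreeSlotMixedCells_three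

/-! ### The mixed step over four events and its closure theorems -/

/-- **MIXED ONE-COORDINATE STEP OVER FOUR EVENTS.**  For every finite cube, every quadruple `U` of increasing events ignoring `e` with `CombHereditary U`, and all
selectors `G₁` (OR) and `G₂` (AND), the family `orAndCoord U e G₁ G₂` is `CombHereditary`. [this work] -/
theorem combHereditary_orAndCoord_four (U : Fin 4 → Set (Set ι)) (e : ι) (G₁ G₂ : Fin 4 → Bool) (hUup : ∀ j, IsUpperSet (U j))
    (hUe : ∀ (j : Fin 4) (b : Bool), secAt e b (U j) = U j) (hU : CombHereditary U) : CombHereditary (orAndCoord U e G₁ G₂) :=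
  combHereditary_orAndCoord_four_of_cells combCanonThreeSlotMixedCells_all combFourSingletonMixedCells U e G₁ G₂ hUup hUe hU

/-- **GROWING FOUR EVENTS BY MIXED STEPS.**  Four increasing events determined by `S` with `CombHereditary U`, grown by any list of mixed steps reading pairwise
distinct coordinates outside `S`, stay `CombHereditary`. [this work] -/
theorem combHereditary_grow₂_four {U : Fin 4 → Set (Set ι)} (hUup : ∀ j, IsUpperSet (U j)) {S : Set ι} (hUS : ∀ j, DeterminedBy (U j) S)
    (hU : CombHereditary U) (L : List (ι × (Fin 4 → Bool) × (Fin 4 → Bool))) (hL : (L.map Prod.fst).Nodup) (hS : ∀ s ∈ L, s.1 ∉ S) :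
    CombHereditary (grow₂ U L) :=
  combHereditary_grow₂_four_of_cells combCanonThreeSlotMixedCells_all combFourSingletonMixedCells hUup hUS hU L hL hS

/-- **EVERY QUADRUPLE OF COMMON-ORDER MONOTONE DECISION LISTS IS HEREDITARILY COMB-POSITIVE.**  From a constant start (member `j` is `Ω` if `c j`, else `∅`),
any list of mixed steps with pairwise distinct coordinates produces a `CombHereditary` quadruple. [this work] -/
theorem combHereditary_decisionList_four (c : Fin 4 → Bool) (L : List (ι × (Fin 4 → Bool) × (Fin 4 → Bool))) (hL : (L.map Prod.fst).Nodup) :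
    CombHereditary (grow₂ (fun j => bif c j then (Set.univ : Set (Set ι)) else ∅) L) :=
  combHereditary_decisionList_four_of_cells combCanonThreeSlotMixedCells_all combFourSingletonMixedCells c L hL

/-- The same with every literal `{e ∈ ω}` replaced by an increasing gadget `G e ⊆ 2^ι` on its own block of coordinates (blocks = fibres of `π : ι → κ`): the
substituted quadruple is `CombHereditary` on `2^ι` (`CombHereditary.readOnce`). [this work] -/
theorem combHereditary_decisionList_four_readOnce {κ : Type} [Fintype κ] (π : ι → κ) (G : κ → Set (Set ι)) (hG : ∀ e, DeterminedBy (G e) {i | π i = e})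
    (c : Fin 4 → Bool) (L : List (κ × (Fin 4 → Bool) × (Fin 4 → Bool))) (hL : (L.map Prod.fst).Nodup) :
    CombHereditary (fun j => {ω : Set ι | {e | ω ∈ G e} ∈ grow₂ (fun j => bif c j then (Set.univ : Set (Set κ)) else ∅) L j}) :=
  (combHereditary_decisionList_four c L hL).readOnce π G hG

/-- Law-level shadow: `E_4 ≥ 0` (indeed every row of the ∩-closed family) for every quadruple of common-order monotone decision lists under every product measure.
[this work] -/
theorem sahiE_four_decisionList_nonneg (c : Fin 4 → Bool) (L : List (ι × (Fin 4 → Bool) × (Fin 4 → Bool))) (hL : (L.map Prod.fst).Nodup)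
    (p : ι → unitInterval) :
    0 ≤ sahiE (bernoulliWeight p) 4 (fun j => ind (grow₂ (fun j => bif c j then (Set.univ : Set (Set ι)) else ∅) L j)) := by
  have h := ((combHereditary_decisionList_four c L hL).hereditaryAllOrders p) 4 (fun j => {j})
  refine le_of_le_of_eq h ?_
  congr 1; funext j
  rw [Finset.set_biInter_singleton]

/-- Every row of the ∩-closed family of such a quadruple is nonnegative under every product measure. [this work] -/
theorem hereditaryAllOrders_decisionList_four (c : Fin 4 → Bool) (L : List (ι × (Fin 4 → Bool) × (Fin 4 → Bool))) (hL : (L.map Prod.fst).Nodup)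
    (p : ι → unitInterval) :
    SahiMixture.HereditaryAllOrders (bernoulliWeight p) (grow₂ (fun j => bif c j then (Set.univ : Set (Set ι)) else ∅) L) :=
  (combHereditary_decisionList_four c L hL).hereditaryAllOrders p

end SahiCombMix

end Summit.CriticalPhenomena.PercolationContinuityZ3.Theorems

end
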